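import Summits.QuantumFields.GaugeBoot.StrongCouplingWords
import Summits.QuantumFields.GaugeBoot.LoopEquationTwoWords
import Summits.QuantumFields.GaugeBoot.StrongCouplingOneStep
import HarnessLib

/-!
# Strong coupling from the loop equation, II: the doubly-wound plaquette and its double traces (gauge-boot, ADDENDUM 22 part C, file 2/2)

HONEST FRAMING (cell `pub-gaugeboot`, page 1 of every file): the venture produces certified bounds
on lattice expectations at stated coupling, gauge group, dimension and torus size; NOT a mass gap,
NOT a continuum limit, NOT a string tension; NOT Yang–Mills-summit-bearing (barriers
`FixedCouplingUltralocality`, `PerturbativeInvisibility`).  Exact identities and crude explicit bounds on a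
finite torus `(ℤ/L)^d`, `L ≥ 2`, every real `β`; no number of the cell's tables is certified here.

## Content

In the loop equation of the plaquette `P̃₀ = P̃_{ν₀,+}` at its first edge `e = (x, μ)` the deformation by `P̃₀` itself
produces the DOUBLY-WOUND plaquette `P̃₀·P̃₀` (`tr ρ(U_P²)`), whose own loop equation has TWO split terms (`e` is
traversed twice) and so involves the double trace `(tr ρ(U_P))²`; the two-word loop equation of
`LoopEquationTwoWords` (marked `P̃₀`, spectator `P̃₀`) supplies the second relation between the two.  This file
computes, pointwise and exactly (any `ρ`, weight `s`):
* `sum_splitTerm_double` — split sum of `P̃₀·P̃₀` at `e`: `(N − s/N)·tr hol(P̃₀P̃₀) + (tr hol P̃₀)² − (s/N)·tr hol(P̃₀P̃₀)`;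
* `sum_mergeTerm_self` — merge sum of (`P̃₀`; spectator `P̃₀`): `tr hol(P̃₀P̃₀) − (s/N)(tr hol P̃₀)²`;
* `sum_mergeTerm_reverse` — merge sum of (`P̃₀`; spectator `P̃₀⁻¹`): `−(N − (s/N)·tr hol P̃₀ · tr hol P̃₀⁻¹)`;
and integrates them against Wilson's measure (lattice representation `r`, pair identities as hypotheses):
* `doublyWound_identity` — `(N − 2s/N)·E[tr hol(P̃₀P̃₀)] + E[(tr hol P̃₀)²] = −(β/2)ΣΣ E[plaqTerm(P̃₀P̃₀)]`;
* `spectator_self_identity` — `(N − 2s/N)·E[(tr hol P̃₀)²] + E[tr hol(P̃₀P̃₀)] = −(β/2)ΣΣ E[plaqTerm(P̃₀)·tr hol P̃₀]`;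
* `spectator_reverse_identity` — `N·E[tr hol P̃₀ · tr hol P̃₀⁻¹] − N = −(β/2)ΣΣ E[plaqTerm(P̃₀)·tr hol P̃₀⁻¹]`
  (for unitary `ρ`: `E|tr U_P|² = 1 + O(β)`, explicitly);
* `norm_sum_sum_integral_plaqTerm_mul_trace_le` — the right sides are `≤ (d−1)·2·2N²(1+|s|)` in modulus.

References: Yu. Makeenko, *Methods of contemporary gauge theory* (2002) Problem 12.7; V. Kazakov, Z. Zheng,
arXiv:2404.16925 §2.3.  Everything is `[folklore]`.
-/

noncomputable section

open MeasureTheory Filter Topology NormedSpace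
open scoped Matrix.Norms.Frobenius Matrix
open Literature.MathematicalPhysics.QuantumFieldTheory
open Summit.QuantumFields.YangMills.Cruxes.CurvatureAmnesia.WardDefect.SchwingerDyson

namespace Summit.QuantumFields.GaugeBoot

namespace StrongCoupling

variable {d L N : ℕ} {G : Type} [Group G] {ρ : G →* Matrix (Fin N) (Fin N) ℂ}

/-! ## Pointwise: the doubly-wound plaquette and the two spectator merge sums -/

section Pointwise

/-- `P̃₀ · P̃₀` as an explicit list. [folklore] -/
theorem plaqWord_true_append_self (μ ν₀ : Fin d) : plaqWord μ ν₀ true ++ plaqWord μ ν₀ true =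
    [.fwd μ, .fwd ν₀, .bwd μ, .bwd ν₀, .fwd μ, .fwd ν₀, .bwd μ, .bwd ν₀] := rfl

/-- After the four letters of `P̃₀` the walker is back at `x`. [folklore] -/
theorem siteAt_double_four (x : Site d L) (μ ν₀ : Fin d) :
    Word.siteAt x ([.fwd μ, .fwd ν₀, .bwd μ, .bwd ν₀, .fwd μ, .fwd ν₀, .bwd μ, .bwd ν₀] : Word d) 4 = x := by
  simp only [Word.siteAt, List.take_succ_cons, List.take_zero, Word.endpoint_cons, Word.endpoint_nil, Step.apply_fwd,
    Step.apply_bwd, Site.shift]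
  abel

variable (ρ) in
/-- ★ **Split sum of the doubly-wound plaquette** `P̃₀·P̃₀ = +μ +ν₀ −μ −ν₀ +μ +ν₀ −μ −ν₀` at `(x, μ)` (`L ≥ 2`): the edge
is traversed forward at letters `0` and `4`, so
`Σ_k splitTerm_k = (N − s/N)·tr hol(P̃₀P̃₀) + ((tr hol P̃₀)² − (s/N)·tr hol(P̃₀P̃₀))`. [folklore] -/
theorem sum_splitTerm_double (hL : (1 : ZMod L) ≠ 0) (s : ℂ) (x : Site d L) {μ ν₀ : Fin d} (hμν₀ : μ ≠ ν₀)
    (U : GaugeConfig d L G) :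
    ∑ k ∈ Finset.range (plaqWord μ ν₀ true ++ plaqWord μ ν₀ true).length,
        splitTerm ρ s x μ U (plaqWord μ ν₀ true ++ plaqWord μ ν₀ true) k =
      ((N : ℂ) - s / N) * (ρ (wordHolonomy U x (plaqWord μ ν₀ true ++ plaqWord μ ν₀ true))).trace +
        ((ρ (wordHolonomy U x (plaqWord μ ν₀ true))).trace * (ρ (wordHolonomy U x (plaqWord μ ν₀ true))).trace -
          s / N * (ρ (wordHolonomy U x (plaqWord μ ν₀ true ++ plaqWord μ ν₀ true))).trace) := by
  rw [plaqWord_true_append_self]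
  set W : Word d := [.fwd μ, .fwd ν₀, .bwd μ, .bwd ν₀, .fwd μ, .fwd ν₀, .bwd μ, .bwd ν₀] with hW
  have hP : plaqWord μ ν₀ true = [.fwd μ, .fwd ν₀, .bwd μ, .bwd ν₀] := rfl
  have hlen : W.length = 8 := by rw [hW]; rfl
  rw [hlen]
  simp only [Finset.sum_range_succ, Finset.sum_range_zero, zero_add]
  have hνμ : ν₀ ≠ μ := fun h => hμν₀ h.symm
  have h0 : splitTerm ρ s x μ U W 0 = ((N : ℂ) - s / N) * (ρ (wordHolonomy U x W)).trace := by
    unfold splitTerm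
    simp only [hW, List.getElem?_cons_zero, Word.siteAt_zero, Step.edge_fwd, if_true, Step.isFwd_fwd, List.take_zero,
      wordHolonomy_nil, map_one, Matrix.trace_one, Fintype.card_fin, List.drop_zero]
    ring
  have h1 : splitTerm ρ s x μ U W 1 = 0 :=
    splitTerm_eq_zero_of_edge_ne s x μ U (w := W) (k := 1) (st := .fwd ν₀) (by rw [hW]; rfl)
      (Step.edge_ne_of_axis_ne hνμ)
  have h3 : splitTerm ρ s x μ U W 3 = 0 :=
    splitTerm_eq_zero_of_edge_ne s x μ U (w := W) (k := 3) (st := .bwd ν₀) (by rw [hW]; rfl)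
      (Step.edge_ne_of_axis_ne hνμ)
  have h5 : splitTerm ρ s x μ U W 5 = 0 :=
    splitTerm_eq_zero_of_edge_ne s x μ U (w := W) (k := 5) (st := .fwd ν₀) (by rw [hW]; rfl)
      (Step.edge_ne_of_axis_ne hνμ)
  have h7 : splitTerm ρ s x μ U W 7 = 0 :=
    splitTerm_eq_zero_of_edge_ne s x μ U (w := W) (k := 7) (st := .bwd ν₀) (by rw [hW]; rfl)
      (Step.edge_ne_of_axis_ne hνμ)
  have h2 : splitTerm ρ s x μ U W 2 = 0 :=
    splitTerm_eq_zero_of_edge_ne s x μ U (w := W) (k := 2) (st := .bwd μ) (by rw [hW]; rfl)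
      (Step.bwd_edge_ne (site_ne_of_apply_ne ν₀ (by
        simp only [hW, Word.siteAt, List.take_succ_cons, List.take_zero, Word.endpoint_cons, Word.endpoint_nil,
          Step.apply_fwd, Site.shift, Pi.add_apply, Pi.sub_apply, Pi.single_eq_same, Pi.single_eq_of_ne hνμ]
        exact zmod_ne_of_sub_eq_one hL (by ring))))
  have h6 : splitTerm ρ s x μ U W 6 = 0 :=
    splitTerm_eq_zero_of_edge_ne s x μ U (w := W) (k := 6) (st := .bwd μ) (by rw [hW]; rfl)
      (Step.bwd_edge_ne (site_ne_of_apply_ne ν₀ (by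
        simp only [hW, Word.siteAt, List.take_succ_cons, List.take_zero, Word.endpoint_cons, Word.endpoint_nil,
          Step.apply_fwd, Step.apply_bwd, Site.shift, Pi.add_apply, Pi.sub_apply, Pi.single_eq_same,
          Pi.single_eq_of_ne hνμ]
        exact zmod_ne_of_sub_eq_one hL (by ring))))
  have h4 : splitTerm ρ s x μ U W 4 = (ρ (wordHolonomy U x (plaqWord μ ν₀ true))).trace *
      (ρ (wordHolonomy U x (plaqWord μ ν₀ true))).trace - s / N * (ρ (wordHolonomy U x W)).trace := by
    have hs4 : Word.siteAt x W 4 = x := by rw [hW]; exact siteAt_double_four x μ ν₀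
    unfold splitTerm
    rw [show W[4]? = some (.fwd μ) by rw [hW]; rfl]
    simp only [hs4, Step.edge_fwd, if_true, Step.isFwd_fwd]
    rw [show W.take 4 = plaqWord μ ν₀ true by rw [hW, hP]; rfl, show W.drop 4 = plaqWord μ ν₀ true by rw [hW, hP]; rfl]
  rw [h0, h1, h2, h3, h4, h5, h6, h7]
  ring

variable (ρ) in
/-- ★ **Merge sum, spectator = the marked plaquette itself**: for (`w = P̃₀`; `v = P̃₀` read from `x`) at `(x, μ)`:
`Σ_{k'} mergeTerm_{k'} = tr hol(P̃₀P̃₀) − (s/N)·(tr hol P̃₀)²` (only `k' = 0` joins). [folklore] -/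
theorem sum_mergeTerm_self (hL : (1 : ZMod L) ≠ 0) (s : ℂ) (x : Site d L) {μ ν₀ : Fin d} (hμν₀ : μ ≠ ν₀)
    (U : GaugeConfig d L G) :
    ∑ k ∈ Finset.range (plaqWord μ ν₀ true).length,
        mergeTerm ρ s x μ U (plaqWord μ ν₀ true) x (plaqWord μ ν₀ true) k =
      (ρ (wordHolonomy U x (plaqWord μ ν₀ true ++ plaqWord μ ν₀ true))).trace -
        s / N * ((ρ (wordHolonomy U x (plaqWord μ ν₀ true))).trace * (ρ (wordHolonomy U x (plaqWord μ ν₀ true))).trace) := by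
  have hP : plaqWord μ ν₀ true = [.fwd μ, .fwd ν₀, .bwd μ, .bwd ν₀] := rfl
  have hνμ : ν₀ ≠ μ := fun h => hμν₀ h.symm
  rw [show (plaqWord μ ν₀ true).length = 4 from rfl]
  simp only [Finset.sum_range_succ, Finset.sum_range_zero, zero_add]
  have h0 : mergeTerm ρ s x μ U (plaqWord μ ν₀ true) x (plaqWord μ ν₀ true) 0 =
      (ρ (wordHolonomy U x (plaqWord μ ν₀ true ++ plaqWord μ ν₀ true))).trace -
        s / N * ((ρ (wordHolonomy U x (plaqWord μ ν₀ true))).trace *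
          (ρ (wordHolonomy U x (plaqWord μ ν₀ true))).trace) := by
    unfold mergeTerm
    rw [show (plaqWord μ ν₀ true)[0]? = some (.fwd μ) from rfl]
    simp only [Word.siteAt_zero, Step.edge_fwd, if_true, Step.isFwd_fwd, List.drop_zero, List.take_zero, wordHolonomy_nil,
      map_one, mul_one, ← map_mul, wordHolonomy_append, endpoint_plaqWord]
  have h1 : mergeTerm ρ s x μ U (plaqWord μ ν₀ true) x (plaqWord μ ν₀ true) 1 = 0 :=
    mergeTerm_eq_zero_of_edge_ne s x μ U _ x (v := plaqWord μ ν₀ true) (k := 1) (st := .fwd ν₀) rfl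
      (Step.edge_ne_of_axis_ne hνμ)
  have h2 : mergeTerm ρ s x μ U (plaqWord μ ν₀ true) x (plaqWord μ ν₀ true) 2 = 0 :=
    mergeTerm_eq_zero_of_edge_ne s x μ U _ x (v := plaqWord μ ν₀ true) (k := 2) (st := .bwd μ) rfl
      (Step.bwd_edge_ne (site_ne_of_apply_ne ν₀ (by
        simp only [hP, Word.siteAt, List.take_succ_cons, List.take_zero, Word.endpoint_cons, Word.endpoint_nil,
          Step.apply_fwd, Site.shift, Pi.add_apply, Pi.sub_apply, Pi.single_eq_same, Pi.single_eq_of_ne hνμ]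
        exact zmod_ne_of_sub_eq_one hL (by ring))))
  have h3 : mergeTerm ρ s x μ U (plaqWord μ ν₀ true) x (plaqWord μ ν₀ true) 3 = 0 :=
    mergeTerm_eq_zero_of_edge_ne s x μ U _ x (v := plaqWord μ ν₀ true) (k := 3) (st := .bwd ν₀) rfl
      (Step.edge_ne_of_axis_ne hνμ)
  rw [h0, h1, h2, h3]
  ring

variable (ρ) in
/-- ★ **Merge sum, spectator = the reversed plaquette** `P̃₀⁻¹ = +ν₀ +μ −ν₀ −μ` (read from `x`): only its last letter
traverses `(x, μ)`, backward, joining `P̃₀` with `P̃₀⁻¹` into the trivial loop: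
`Σ_{k'} mergeTerm_{k'} = −(N − (s/N)·tr hol P̃₀ · tr hol P̃₀⁻¹)`. [folklore] -/
theorem sum_mergeTerm_reverse (hL : (1 : ZMod L) ≠ 0) (s : ℂ) (x : Site d L) {μ ν₀ : Fin d} (hμν₀ : μ ≠ ν₀)
    (U : GaugeConfig d L G) :
    ∑ k ∈ Finset.range (plaqWord μ ν₀ true).reverse.length,
        mergeTerm ρ s x μ U (plaqWord μ ν₀ true) x (plaqWord μ ν₀ true).reverse k =
      -((N : ℂ) - s / N * ((ρ (wordHolonomy U x (plaqWord μ ν₀ true))).trace *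
        (ρ (wordHolonomy U x (plaqWord μ ν₀ true).reverse)).trace)) := by
  have hR : (plaqWord μ ν₀ true).reverse = [.fwd ν₀, .fwd μ, .bwd ν₀, .bwd μ] := plaqWord_true_reverse μ ν₀
  have hνμ : ν₀ ≠ μ := fun h => hμν₀ h.symm
  have hone : (ρ (wordHolonomy U x (plaqWord μ ν₀ true)) * ρ (wordHolonomy U x (plaqWord μ ν₀ true).reverse)).trace =
      (N : ℂ) := by
    have h1 := wordHolonomy_append_reverse U x (plaqWord μ ν₀ true)
    rw [wordHolonomy_append, endpoint_plaqWord] at h1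
    rw [← map_mul, h1, map_one, Matrix.trace_one, Fintype.card_fin]
  rw [hR] at hone ⊢
  rw [show ([.fwd ν₀, .fwd μ, .bwd ν₀, .bwd μ] : Word d).length = 4 from rfl]
  simp only [Finset.sum_range_succ, Finset.sum_range_zero, zero_add]
  have hs3 : Word.siteAt x ([.fwd ν₀, .fwd μ, .bwd ν₀, .bwd μ] : Word d) 3 = x.shift μ := by
    simp only [Word.siteAt, List.take_succ_cons, List.take_zero, Word.endpoint_cons, Word.endpoint_nil, Step.apply_fwd,
      Step.apply_bwd, Site.shift]
    abel
  have hs4 : Word.siteAt x ([.fwd ν₀, .fwd μ, .bwd ν₀, .bwd μ] : Word d) 4 = x := by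
    simp only [Word.siteAt, List.take_succ_cons, List.take_zero, Word.endpoint_cons, Word.endpoint_nil, Step.apply_fwd,
      Step.apply_bwd, Site.shift]
    abel
  have h0 : mergeTerm ρ s x μ U (plaqWord μ ν₀ true) x [.fwd ν₀, .fwd μ, .bwd ν₀, .bwd μ] 0 = 0 :=
    mergeTerm_eq_zero_of_edge_ne s x μ U _ x (v := [.fwd ν₀, .fwd μ, .bwd ν₀, .bwd μ]) (k := 0) (st := .fwd ν₀) rfl
      (Step.edge_ne_of_axis_ne hνμ)
  have h1 : mergeTerm ρ s x μ U (plaqWord μ ν₀ true) x [.fwd ν₀, .fwd μ, .bwd ν₀, .bwd μ] 1 = 0 :=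
    mergeTerm_eq_zero_of_edge_ne s x μ U _ x (v := [.fwd ν₀, .fwd μ, .bwd ν₀, .bwd μ]) (k := 1) (st := .fwd μ) rfl
      (Step.fwd_edge_ne (site_ne_of_apply_ne ν₀ (by
        simp only [Word.siteAt, List.take_succ_cons, List.take_zero, Word.endpoint_cons, Word.endpoint_nil,
          Step.apply_fwd, Site.shift, Pi.add_apply, Pi.single_eq_same]
        exact zmod_ne_of_sub_eq_one hL (by ring))))
  have h2 : mergeTerm ρ s x μ U (plaqWord μ ν₀ true) x [.fwd ν₀, .fwd μ, .bwd ν₀, .bwd μ] 2 = 0 :=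
    mergeTerm_eq_zero_of_edge_ne s x μ U _ x (v := [.fwd ν₀, .fwd μ, .bwd ν₀, .bwd μ]) (k := 2) (st := .bwd ν₀) rfl
      (Step.edge_ne_of_axis_ne hνμ)
  have h3 : mergeTerm ρ s x μ U (plaqWord μ ν₀ true) x [.fwd ν₀, .fwd μ, .bwd ν₀, .bwd μ] 3 =
      -((N : ℂ) - s / N * ((ρ (wordHolonomy U x (plaqWord μ ν₀ true))).trace *
        (ρ (wordHolonomy U x [.fwd ν₀, .fwd μ, .bwd ν₀, .bwd μ])).trace)) := by
    unfold mergeTerm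
    rw [show ([.fwd ν₀, .fwd μ, .bwd ν₀, .bwd μ] : Word d)[3]? = some (.bwd μ) from rfl]
    have hedge : (Step.bwd μ).edge (Word.siteAt x ([.fwd ν₀, .fwd μ, .bwd ν₀, .bwd μ] : Word d) 3) = (x, μ) := by
      rw [hs3, Step.edge_bwd, Site.shift, add_sub_cancel_right]
    simp only [hedge, if_true, Step.isFwd_bwd, Bool.false_eq_true, if_false, hs4]
    rw [show ([.fwd ν₀, .fwd μ, .bwd ν₀, .bwd μ] : Word d).drop (3 + 1) = [] from rfl,
      show ([.fwd ν₀, .fwd μ, .bwd ν₀, .bwd μ] : Word d).take (3 + 1) = [.fwd ν₀, .fwd μ, .bwd ν₀, .bwd μ] from rfl,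
      wordHolonomy_nil, map_one, Matrix.one_mul, hone]
  rw [h0, h1, h2, h3]
  ring

end Pointwise

/-! ## Integrated: the three identities and the bound on their right sides -/

section Integrated

variable [TopologicalSpace G] [IsTopologicalGroup G] [CompactSpace G] [MeasurableSpace G] [BorelSpace G]
  (r : LatticeRep G) [NeZero L]

omit [IsTopologicalGroup G] [CompactSpace G] [MeasurableSpace G] [BorelSpace G] [NeZero L] in
/-- **Pointwise bound** `‖plaqTerm · tr ρ(hol v)‖ ≤ 2N(1+‖s‖)·N`. [folklore] -/
theorem norm_plaqTerm_mul_trace_le (s : ℂ) (x : Site d L) (μ : Fin d) (U : GaugeConfig d L G) (w : Word d) (ν : Fin d)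
    (ε : Bool) (x₁ : Site d L) (v : Word d) :
    ‖plaqTerm r.ρ s x μ U w ν ε * (r.ρ (wordHolonomy U x₁ v)).trace‖ ≤ 2 * r.N * (1 + ‖s‖) * r.N := by
  rw [norm_mul]
  exact mul_le_mul (norm_plaqTerm_le r s x μ U w ν ε) (norm_trace_le r _) (norm_nonneg _) (by positivity)

/-- **The right sides with a spectator are bounded**: `‖ΣΣ E[plaqTerm·tr hol v]‖ ≤ (d−1)·2·(2N(1+‖s‖)·N)`. [folklore] -/
theorem norm_sum_sum_integral_plaqTerm_mul_trace_le (β : ℝ) (s : ℂ) (x : Site d L) (μ : Fin d) (w : Word d)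
    (x₁ : Site d L) (v : Word d) :
    ‖∑ ν ∈ Finset.univ.erase μ, ∑ ε : Bool, ∫ U, plaqTerm r.ρ s x μ U w ν ε * (r.ρ (wordHolonomy U x₁ v)).trace
        ∂(wilsonMeasure (d := d) (L := L) r.ρ β)‖ ≤ ((d : ℝ) - 1) * (2 * (2 * r.N * (1 + ‖s‖) * r.N)) := by
  haveI := isProbabilityMeasure_wilsonMeasure (d := d) (L := L) r.ρ r.continuous β
  have hterm : ∀ ν ε, ‖∫ U, plaqTerm r.ρ s x μ U w ν ε * (r.ρ (wordHolonomy U x₁ v)).trace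
      ∂(wilsonMeasure (d := d) (L := L) r.ρ β)‖ ≤ 2 * r.N * (1 + ‖s‖) * r.N := fun ν ε => by
    have h := norm_integral_le_of_norm_le_const (μ := wilsonMeasure (d := d) (L := L) r.ρ β)
      (ae_of_all _ fun U => norm_plaqTerm_mul_trace_le r s x μ U w ν ε x₁ v)
    rwa [probReal_univ, mul_one] at h
  calc _ ≤ ∑ ν ∈ Finset.univ.erase μ, ‖∑ ε : Bool, ∫ U, plaqTerm r.ρ s x μ U w ν ε * (r.ρ (wordHolonomy U x₁ v)).trace
          ∂(wilsonMeasure (d := d) (L := L) r.ρ β)‖ := norm_sum_le _ _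
    _ ≤ ∑ ν ∈ Finset.univ.erase μ, (2 * (2 * r.N * (1 + ‖s‖) * r.N)) := by
        refine Finset.sum_le_sum fun ν _ => (norm_sum_le _ _).trans ?_
        calc _ ≤ ∑ _ε : Bool, 2 * r.N * (1 + ‖s‖) * r.N := Finset.sum_le_sum fun ε _ => hterm ν ε
          _ = 2 * (2 * r.N * (1 + ‖s‖) * r.N) := by simp [two_mul]
    _ = ((d : ℝ) - 1) * (2 * (2 * r.N * (1 + ‖s‖) * r.N)) := by
        rw [Finset.sum_const, nsmul_eq_mul, card_univ_erase_real]

/-- ★★ **The doubly-wound identity.**  With `b = E[tr hol(P̃₀P̃₀)]`, `a = E[(tr hol P̃₀)²]` (Wilson's measure at `β`):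
`(N − 2s/N)·b + a = −(β/2)·Σ_{ν≠μ,ε} E[plaqTerm_{ν,ε}(P̃₀P̃₀)]` — the loop equation of the doubly-wound plaquette.
[folklore] -/
theorem doublyWound_identity (hL : (1 : ZMod L) ≠ 0) (β : ℝ) (x : Site d L) {μ ν₀ : Fin d} (hμν₀ : μ ≠ ν₀) (s : ℂ)
    (hP : ∀ i j : Fin r.N, SDPair r β x μ x (plaqWord μ ν₀ true ++ plaqWord μ ν₀ true) (unitDir s i j)) :
    ((r.N : ℂ) - 2 * s / r.N) * ∫ U, (r.ρ (wordHolonomy U x (plaqWord μ ν₀ true ++ plaqWord μ ν₀ true))).trace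
        ∂(wilsonMeasure (d := d) (L := L) r.ρ β) +
      ∫ U, (r.ρ (wordHolonomy U x (plaqWord μ ν₀ true))).trace * (r.ρ (wordHolonomy U x (plaqWord μ ν₀ true))).trace
        ∂(wilsonMeasure (d := d) (L := L) r.ρ β) =
      -((β / 2 : ℂ) * ∑ ν ∈ Finset.univ.erase μ, ∑ ε : Bool,
        ∫ U, plaqTerm r.ρ s x μ U (plaqWord μ ν₀ true ++ plaqWord μ ν₀ true) ν ε
          ∂(wilsonMeasure (d := d) (L := L) r.ρ β)) := by
  have hcl : Word.endpoint x (plaqWord μ ν₀ true ++ plaqWord μ ν₀ true) = x := by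
    rw [Word.endpoint_append, endpoint_plaqWord, endpoint_plaqWord]
  have h := loopEquation_of_sdPair r β x μ s _ hcl hP
  rw [← integral_finsetSum _ fun k _ => integrable_of_continuous r β (continuous_splitTerm r s x μ _ k)] at h
  simp_rw [sum_splitTerm_double r.ρ hL s x hμν₀] at h
  have hi1 := integrable_trace_wordHolonomy_latticeRep (d := d) (L := L) r β x (plaqWord μ ν₀ true ++ plaqWord μ ν₀ true)
  have hi2 := integrable_trace_mul_trace_latticeRep (d := d) (L := L) r β x x (plaqWord μ ν₀ true) (plaqWord μ ν₀ true)
  have hi3 : Integrable (fun U : GaugeConfig d L G =>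
      (r.ρ (wordHolonomy U x (plaqWord μ ν₀ true))).trace * (r.ρ (wordHolonomy U x (plaqWord μ ν₀ true))).trace -
        s / r.N * (r.ρ (wordHolonomy U x (plaqWord μ ν₀ true ++ plaqWord μ ν₀ true))).trace)
      (wilsonMeasure (d := d) (L := L) r.ρ β) := hi2.sub (hi1.const_mul _)
  have hi4 : Integrable (fun U : GaugeConfig d L G =>
      ((r.N : ℂ) - s / r.N) * (r.ρ (wordHolonomy U x (plaqWord μ ν₀ true ++ plaqWord μ ν₀ true))).trace)
      (wilsonMeasure (d := d) (L := L) r.ρ β) := hi1.const_mul _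
  rw [integral_add hi4 hi3, integral_const_mul, integral_sub hi2 (hi1.const_mul _), integral_const_mul] at h
  linear_combination h

/-- ★★ **The self-spectator identity.**  With `a = E[(tr hol P̃₀)²]`, `b = E[tr hol(P̃₀P̃₀)]`:
`(N − 2s/N)·a + b = −(β/2)·Σ_{ν≠μ,ε} E[plaqTerm_{ν,ε}(P̃₀)·tr hol P̃₀]` — the two-word loop equation with the marked
plaquette as its own spectator. [folklore] -/
theorem spectator_self_identity (hL : (1 : ZMod L) ≠ 0) (β : ℝ) (x : Site d L) {μ ν₀ : Fin d} (hμν₀ : μ ≠ ν₀) (s : ℂ)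
    (hP : ∀ i j : Fin r.N, SDPair₂ r β x μ x (plaqWord μ ν₀ true) x (plaqWord μ ν₀ true) (unitDir s i j)) :
    ((r.N : ℂ) - 2 * s / r.N) * ∫ U, (r.ρ (wordHolonomy U x (plaqWord μ ν₀ true))).trace *
        (r.ρ (wordHolonomy U x (plaqWord μ ν₀ true))).trace ∂(wilsonMeasure (d := d) (L := L) r.ρ β) +
      ∫ U, (r.ρ (wordHolonomy U x (plaqWord μ ν₀ true ++ plaqWord μ ν₀ true))).trace
        ∂(wilsonMeasure (d := d) (L := L) r.ρ β) =
      -((β / 2 : ℂ) * ∑ ν ∈ Finset.univ.erase μ, ∑ ε : Bool,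
        ∫ U, plaqTerm r.ρ s x μ U (plaqWord μ ν₀ true) ν ε * (r.ρ (wordHolonomy U x (plaqWord μ ν₀ true))).trace
          ∂(wilsonMeasure (d := d) (L := L) r.ρ β)) := by
  have h := loopEquation₂_of_sdPair₂ r β x μ s (plaqWord μ ν₀ true) (endpoint_plaqWord x μ ν₀ true) x
    (plaqWord μ ν₀ true) hP
  rw [← integral_finsetSum _ fun k _ => integrable_of_continuous r β
      (F := fun U => splitTerm r.ρ s x μ U (plaqWord μ ν₀ true) k * (r.ρ (wordHolonomy U x (plaqWord μ ν₀ true))).trace)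
      ((continuous_splitTerm r s x μ _ k).mul (continuous_trace_wordHolonomy r x _)),
    ← integral_finsetSum _ fun k _ => integrable_of_continuous r β (continuous_mergeTerm r s x μ _ x _ k)] at h
  simp_rw [← Finset.sum_mul, Equipartition.sum_splitTerm_plaqWord r.ρ hL s x hμν₀ _ true,
    sum_mergeTerm_self r.ρ hL s x hμν₀] at h
  have hi1 := integrable_trace_wordHolonomy_latticeRep (d := d) (L := L) r β x (plaqWord μ ν₀ true ++ plaqWord μ ν₀ true)
  have hi2 := integrable_trace_mul_trace_latticeRep (d := d) (L := L) r β x x (plaqWord μ ν₀ true) (plaqWord μ ν₀ true)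
  have e1 : ∀ U : GaugeConfig d L G, ((r.N : ℂ) - s / r.N) * (r.ρ (wordHolonomy U x (plaqWord μ ν₀ true))).trace *
      (r.ρ (wordHolonomy U x (plaqWord μ ν₀ true))).trace = ((r.N : ℂ) - s / r.N) *
        ((r.ρ (wordHolonomy U x (plaqWord μ ν₀ true))).trace * (r.ρ (wordHolonomy U x (plaqWord μ ν₀ true))).trace) :=
    fun U => by ring
  simp_rw [e1] at h
  rw [integral_const_mul, integral_sub hi1 (hi2.const_mul _), integral_const_mul] at h
  linear_combination h

/-- ★★ **The reverse-spectator identity.**  With `c = E[tr hol P̃₀ · tr hol P̃₀⁻¹]` (`= E|tr U_P|²` for unitary `ρ`):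
`N·c − N = −(β/2)·Σ_{ν≠μ,ε} E[plaqTerm_{ν,ε}(P̃₀)·tr hol P̃₀⁻¹]` — at strong coupling `E|tr U_P|² = 1 + O(β)` with an
explicit constant (the Haar value `1` emerges from the merge term, without any Weingarten calculus). [folklore] -/
theorem spectator_reverse_identity (hL : (1 : ZMod L) ≠ 0) (β : ℝ) (x : Site d L) {μ ν₀ : Fin d} (hμν₀ : μ ≠ ν₀)
    (s : ℂ) (hP : ∀ i j : Fin r.N, SDPair₂ r β x μ x (plaqWord μ ν₀ true) x (plaqWord μ ν₀ true).reverse (unitDir s i j)) :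
    (r.N : ℂ) * ∫ U, (r.ρ (wordHolonomy U x (plaqWord μ ν₀ true))).trace *
        (r.ρ (wordHolonomy U x (plaqWord μ ν₀ true).reverse)).trace ∂(wilsonMeasure (d := d) (L := L) r.ρ β) - r.N =
      -((β / 2 : ℂ) * ∑ ν ∈ Finset.univ.erase μ, ∑ ε : Bool,
        ∫ U, plaqTerm r.ρ s x μ U (plaqWord μ ν₀ true) ν ε * (r.ρ (wordHolonomy U x (plaqWord μ ν₀ true).reverse)).trace
          ∂(wilsonMeasure (d := d) (L := L) r.ρ β)) := by
  haveI := isProbabilityMeasure_wilsonMeasure (d := d) (L := L) r.ρ r.continuous β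
  have h := loopEquation₂_of_sdPair₂ r β x μ s (plaqWord μ ν₀ true) (endpoint_plaqWord x μ ν₀ true) x
    (plaqWord μ ν₀ true).reverse hP
  rw [← integral_finsetSum _ fun k _ => integrable_of_continuous r β
      (F := fun U => splitTerm r.ρ s x μ U (plaqWord μ ν₀ true) k *
        (r.ρ (wordHolonomy U x (plaqWord μ ν₀ true).reverse)).trace)
      ((continuous_splitTerm r s x μ _ k).mul (continuous_trace_wordHolonomy r x _)),
    ← integral_finsetSum _ fun k _ => integrable_of_continuous r β (continuous_mergeTerm r s x μ _ x _ k)] at h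
  simp_rw [← Finset.sum_mul, Equipartition.sum_splitTerm_plaqWord r.ρ hL s x hμν₀ _ true,
    sum_mergeTerm_reverse r.ρ hL s x hμν₀] at h
  have hi2 := integrable_trace_mul_trace_latticeRep (d := d) (L := L) r β x x (plaqWord μ ν₀ true)
    (plaqWord μ ν₀ true).reverse
  have e1 : ∀ U : GaugeConfig d L G, ((r.N : ℂ) - s / r.N) * (r.ρ (wordHolonomy U x (plaqWord μ ν₀ true))).trace *
      (r.ρ (wordHolonomy U x (plaqWord μ ν₀ true).reverse)).trace = ((r.N : ℂ) - s / r.N) *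
        ((r.ρ (wordHolonomy U x (plaqWord μ ν₀ true))).trace *
          (r.ρ (wordHolonomy U x (plaqWord μ ν₀ true).reverse)).trace) := fun U => by ring
  simp_rw [e1] at h
  rw [integral_const_mul, integral_neg, integral_sub (integrable_const _) (hi2.const_mul _), integral_const_mul,
    integral_const, probReal_univ, one_smul] at h
  linear_combination h

end Integrated

end StrongCoupling

end Summit.QuantumFields.GaugeBoot

end
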